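import Summits.QuantumFields.GaugeBoot.ERowCanon
import HarnessLib

/-!
# Merge-sort canonical forms for kernel-checked bindings (LEQ-SCALING R2⁺⁺, `n log n`)

Cell `pub-gaugeboot` (HOME `run/shared/lean/pub/pub-gaugeboot/`), seat lean2 — companion of `ERowCanon.lean`.

HONEST FRAMING (page 1 of every file of this cell): certified bounds on lattice expectations at STATED coupling, gauge
group, dimension and torus size; NOT a mass gap, NOT a continuum limit, NOT a string tension, NOT large `N`; NOT
Yang–Mills-summit-bearing (barriers `FixedCouplingUltralocality`, `PerturbativeInvisibility`).

## Why

`ERowCanon.GRow.canon` is an insertion sort: the kernel check `canon r = canon s` of a binding row costs `O(n²)` label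
comparisons (measured: a chunk of rows with `Σ n² ≈ 4.5·10⁵` takes ≈ 20 s of kernel time; a 204-row reduced equality system
≈ 400 s; the aggregated rows needed for the KZ families would not finish).  `GRow.mcanon lt r` computes the same kind of
normal form by a FUELLED MERGE SORT (structural recursion on the fuel, so it reduces in the kernel): `GRow.mergeF` merges two
rows adding the coefficients of equal labels that meet at the heads, `GRow.msortF` splits in halves; zero coefficients are
dropped at the end.  Soundness needs no sortedness: `rowVal_mcanon : rowVal β v (mcanon lt r) = rowVal β v r` for EVERY `lt`
and every fuel (exhausted fuel just concatenates / stops), hence `rowVal_eq_of_mcanon_eq` and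
`rowVal_eq_zero_of_mcanon_eq_lincomb` exactly as for `canon`.  Everything is `[folklore]`.
-/

noncomputable section

open Literature.MathematicalPhysics.QuantumFieldTheory

namespace Summit.QuantumFields.GaugeBoot

section Merge

variable {α : Type} [DecidableEq α] (lt : α → α → Bool)

/-- Fuelled merge of two rows: equal labels meeting at the two heads are added; out of fuel ↦ concatenate the rests. [folklore] -/
def GRow.mergeF : ℕ → GRow α → GRow α → GRow α
  | 0, l, r => l ++ r
  | _ + 1, [], r => r
  | _ + 1, t :: l, [] => t :: l
  | n + 1, t :: l, u :: r =>
      if t.1 = u.1 then (t.1, t.2.1 + u.2.1, t.2.2 + u.2.2) :: GRow.mergeF n l r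
      else if lt t.1 u.1 then t :: GRow.mergeF n l (u :: r) else u :: GRow.mergeF n (t :: l) r

/-- Fuelled merge sort (fuel = recursion depth; out of fuel ↦ unchanged). [folklore] -/
def GRow.msortF : ℕ → GRow α → GRow α
  | 0, r => r
  | _ + 1, [] => []
  | _ + 1, [t] => [t]
  | n + 1, t :: u :: r =>
      GRow.mergeF lt (r.length + 2) (GRow.msortF n ((t :: u :: r).take (r.length / 2 + 1)))
        (GRow.msortF n ((t :: u :: r).drop (r.length / 2 + 1)))

/-- Merge-sort canonical form: sorted by `lt` with equal labels merged (fuel = length), zero coefficients dropped. [folklore] -/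
def GRow.mcanon (r : GRow α) : GRow α := (GRow.msortF lt r.length r).filter fun t => t.2.1 ≠ 0 ∨ t.2.2 ≠ 0

variable (β : ℝ) (v : α → ℝ)

/-- The merge has the value of the two rows together, for every `lt` and every fuel. [folklore] -/
theorem rowVal_mergeF (n : ℕ) (l r : GRow α) : rowVal β v (GRow.mergeF lt n l r) = rowVal β v l + rowVal β v r := by
  induction n generalizing l r with
  | zero => simp [GRow.mergeF]
  | succ n ih =>
    cases l with
    | nil => simp [GRow.mergeF]
    | cons t l =>
      cases r with
      | nil => simp [GRow.mergeF]
      | cons u r =>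
        simp only [GRow.mergeF]
        split_ifs with h1 h2
        · rw [rowVal_cons, ih, rowVal_cons, rowVal_cons, h1]; push_cast; ring
        · rw [rowVal_cons, ih, rowVal_cons, rowVal_cons]; ring
        · rw [rowVal_cons, ih, rowVal_cons, rowVal_cons]; ring

/-- The merge sort preserves the value, for every `lt` and every fuel. [folklore] -/
theorem rowVal_msortF (n : ℕ) (r : GRow α) : rowVal β v (GRow.msortF lt n r) = rowVal β v r := by
  induction n generalizing r with
  | zero => rfl
  | succ n ih =>
    match r with
    | [] => rfl
    | [_] => rfl
    | t :: u :: r =>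
      rw [GRow.msortF, rowVal_mergeF, ih, ih, ← rowVal_append, List.take_append_drop]

/-- **The merge-sort canonical form has the same value**, for every `lt`. [folklore] -/
theorem rowVal_mcanon (r : GRow α) : rowVal β v (GRow.mcanon lt r) = rowVal β v r := by
  unfold GRow.mcanon
  rw [rowVal_filter_ne_zero, rowVal_msortF]

/-- Rows with equal merge-sort canonical forms have equal values. [folklore] -/
theorem rowVal_eq_of_mcanon_eq (r s : GRow α) (h : GRow.mcanon lt r = GRow.mcanon lt s) :
    rowVal β v r = rowVal β v s := by
  rw [← rowVal_mcanon lt β v r, h, rowVal_mcanon]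

/-- **Transfer through merge-sort canonical forms**: a row whose canonical form equals that of a linear combination of
vanishing rows evaluated at the rational coupling `β₀` vanishes at `β₀` (`h` by ONE `decide`). [folklore] -/
theorem rowVal_eq_zero_of_mcanon_eq_lincomb (β₀ : ℚ) (r : GRow α) (cs : List (ℚ × GRow α))
    (h : GRow.mcanon lt r = GRow.mcanon lt (GRow.evalAt β₀ (GRow.lincomb cs))) (hcs : ∀ p ∈ cs, rowVal (β₀ : ℝ) v p.2 = 0) :
    rowVal (β₀ : ℝ) v r = 0 := by
  rw [rowVal_eq_of_mcanon_eq lt (β₀ : ℝ) v r _ h, rowVal_evalAt, rowVal_lincomb_eq_zero _ v cs hcs]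

end Merge

/-- Example (closed computation): the merge-sort canonical form agrees with `GRow.canon` on a small row. [folklore] -/
example : GRow.mcanon Word.ltw ([([.fwd 0, .fwd 1, .bwd 0, .bwd 1], -1, 0), ([], 0, 1), ([.fwd 0, .fwd 1, .bwd 0, .bwd 1], 2, 0),
      ([.fwd 0], 3, 0), ([.fwd 0, .bwd 1], 0, 0)] : ERow) =
    GRow.canon Word.ltw [([], 0, 1), ([.fwd 0], 3, 0), ([.fwd 0, .fwd 1, .bwd 0, .bwd 1], 1, 0)] := by
  decide +kernel

end Summit.QuantumFields.GaugeBoot
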